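import Summits.QuantumFields.YangMills.Theorems.IsotropyFromPowerCountingTemperedCurvatureMomentsOfBddRenormalisation

/-!
# CH_n on the tame sector: the shielded moment bound for bounded multiplicative renormalisation

Support file of the line `Sketch` (card `markov-shielding`) of crux `TemperedCurvatureMoments` (T, stmt-QuantumFields-17721).
The line's residual stub D = CH_n (`stub_shieldedMomentBound` of `Cruxes/TemperedCurvatureMoments/Lines/Sketch.lean`) asks,
for a tied scheme, that the `Lⁿ(μ_k)` law of the SHIELDED renormalised curvature
`g_{k,ρ}(y) = E_k[c_k(F(τ_yŨ) − m_k) | links based outside the sup-cube of radius ⌊ρ/a_k⌋ around y]` be `≤ C ρ^{-p}` at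
fixed physical `ρ ∈ (0,1]`, eventually in `k`.  This file certifies CH_n on the TAME sector — bounded multiplicative
renormalisation `|c_k| ≤ B` — with `p = 0`: the integrand `φ = c_k(F∘τ_y − m_k) = c_k(F∘τ_y − ⟨F⟩_k) + κ_k` is bounded by
`2BM + K` once the renormalised mean `κ_k = c_k(⟨F⟩_k − m_k)` is (the degree-one tie, `eventually_abs_renormalisedMean_le`,
p140303), and conditional expectations of bounded functions are bounded (`ae_bdd_abs_condExp_of_ae_bdd_abs`).  So every
certified inhabitant of the tie with bounded `c` satisfies D; the content of D is the regime `|c_k| → ∞` (physical: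
`c_k ≍ a_k⁻⁴`, `p = 4` expected), exactly as for T itself (`temperedCurvatureMoments_of_bddRenormalisation`).

* `rpow_integral_abs_condExp_pow_le` — `(∫ |E[f|m]|ⁿ dμ)^{1/n} ≤ R` for `|f| ≤ R` on a probability space (any `m ≤ m₀`);
* `shieldedMomentBound_of_bddRenormalisation` — CH_n at `(r, sch)` from the tie and `∃ B, ∀ k, |c_k| ≤ B`.

References: Osterwalder–Seiler 1978 §2 (lattice Yang–Mills expectations); Friedli–Velenik 2017 §6.3 (conditioning on
exterior σ-algebras). [folklore]
-/

noncomputable section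

-- tree-known workaround (cf. the imported support file)
attribute [-instance] SimplexCategory.instFintypeToTypeOrderHomFinHAddNatLenOfNat

namespace Summit.QuantumFields.YangMills.Theorems.TemperedCurvatureMoments.Sketch

open scoped BigOperators
open MeasureTheory Filter Topology
open Literature.MathematicalPhysics.QuantumFieldTheory Literature.MathematicalPhysics.QuantumLattice
open Literature.MathematicalPhysics.AQFT
open Literature.Probability.LatticeModels (box Site)
open Summit.QuantumFields.YangMills.Theorems.OSLegsFromFemtoAndGap (abs_wilsonTorusMean_le)
open Summit.QuantumFields.YangMills.Theorems.CurvatureBoostCovariance.Negative (Tie)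
open Summit.QuantumFields.YangMills.Theorems.NPointIsotropy.Negative (E4)
open Summit.QuantumFields.YangMills.Theorems.SoftKernelBoostCovariance.Sketch (eventually_abs_renormalisedMean_le)

/-- **`Lⁿ`-type bound for the conditional expectation of a bounded function.**  On a probability space, for any
sub-σ-algebra `m ≤ m₀`, if `|f| ≤ R` everywhere (`R ≥ 0`) then `(∫ |E[f|m]|ⁿ dμ)^{1/n} ≤ R` for `n > 0` (the Bochner
integral of a non-integrable function being `0`, no integrability hypothesis is needed). [folklore] -/
theorem rpow_integral_abs_condExp_pow_le {Ω : Type*} {m m0 : MeasurableSpace Ω} (μ : Measure Ω)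
    [IsProbabilityMeasure μ] {f : Ω → ℝ} {R : ℝ} (hR : 0 ≤ R) (hf : ∀ ω, |f ω| ≤ R) {n : ℕ} (hn : 0 < n) :
    (∫ ω, |(μ[f | m]) ω| ^ n ∂μ) ^ ((n : ℝ)⁻¹) ≤ R := by
  have hbd : ∀ᵐ ω ∂μ, |(μ[f | m]) ω| ^ n ≤ R ^ n :=
    (ae_bdd_abs_condExp_of_ae_bdd_abs (m := m) (Eventually.of_forall hf)).mono fun ω hω =>
      pow_le_pow_left₀ (abs_nonneg _) hω n
  have hint : ∫ ω, |(μ[f | m]) ω| ^ n ∂μ ≤ R ^ n := by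
    by_cases hI : Integrable (fun ω => |(μ[f | m]) ω| ^ n) μ
    · have h := integral_mono_ae hI (integrable_const (R ^ n)) hbd
      simpa using h
    · rw [integral_undef hI]
      positivity
  have h0 : 0 ≤ ∫ ω, |(μ[f | m]) ω| ^ n ∂μ := integral_nonneg fun ω => pow_nonneg (abs_nonneg _) n
  calc (∫ ω, |(μ[f | m]) ω| ^ n ∂μ) ^ ((n : ℝ)⁻¹)
      ≤ (R ^ n) ^ ((n : ℝ)⁻¹) := Real.rpow_le_rpow h0 hint (by positivity)
    _ = R := Real.pow_rpow_inv_natCast hR hn.ne'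

variable {G : Type} [Group G] [TopologicalSpace G] [IsTopologicalGroup G] [CompactSpace G]
  [MeasurableSpace G] [BorelSpace G]

/-- **CH_n ON THE TAME SECTOR.**  For a scheme tied to `S₁` (only the degree-one tie is used) with BOUNDED
multiplicative renormalisation of the curvature species, `|c_k| ≤ B` for all `k`, the shielded moment bound CH_n holds
at `(r, sch)` for every `n > 0` with `p = 0` and `C = 2BM + K + 1` (`M` a bound of the Wilson action density, `K` an
eventual bound of the renormalised mean `κ_k = c_k(⟨F⟩_k − m_k)`): the integrand `c_k(F∘τ_y − m_k) = c_k(F∘τ_y − ⟨F⟩_k) + κ_k`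
is bounded by `2BM + K` for `k ≥ k₁`, hence so is its conditional expectation given any exterior σ-algebra, at every
site and every radius. [folklore] -/
theorem shieldedMomentBound_of_bddRenormalisation (r : LatticeRep G) (sch : SpeciesScheme (YMSpecies G))
    (S₁ : SchwingerFamily E4) (htie : Tie r sch S₁) (hB : ∃ B : ℝ, ∀ k : ℕ, |sch.c r.curvature k| ≤ B)
    {n : ℕ} (hn : 0 < n) :
    ∃ (C p : ℝ), 0 < C ∧ ∀ ρ : ℝ, 0 < ρ → ρ ≤ 1 → ∃ k₀ : ℕ, ∀ k : ℕ, k₀ ≤ k →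
      ∀ y : Site 4, y ∈ box 4 (sch.L k / 2) →
        (∫ U, |((wilsonMeasure r.ρ (sch.β k) : Measure (GaugeConfig 4 (2 * sch.L k + 1) G))[(fun U =>
            sch.c r.curvature k *
              (r.curvature.F (configShift (-y) (torusLift (2 * sch.L k + 1) U)) - sch.m r.curvature k)) |
            cylinderEvents {ℓ : Edge 4 (2 * sch.L k + 1) | ¬ ∀ ν : Fin 4,
              (ℓ.1 ν - ((y ν : ℤ) : ZMod (2 * sch.L k + 1)) +
                ((⌊ρ / sch.a k⌋₊ : ℕ) : ZMod (2 * sch.L k + 1))).val ≤ 2 * ⌊ρ / sch.a k⌋₊}]) U| ^ n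
          ∂(wilsonMeasure r.ρ (sch.β k) : Measure (GaugeConfig 4 (2 * sch.L k + 1) G))) ^ ((n : ℝ)⁻¹) ≤
          C * ρ ^ (-p) := by
  obtain ⟨B, hB⟩ := hB
  obtain ⟨M, hM⟩ := r.curvature.bounded
  obtain ⟨K, hK⟩ := eventually_abs_renormalisedMean_le r sch S₁ htie
  obtain ⟨k₁, hk₁⟩ := eventually_atTop.1 hK
  have hM0 : 0 ≤ M := (abs_nonneg _).trans (hM fun _ => 1)
  have hB0 : 0 ≤ B := (abs_nonneg _).trans (hB 0)
  have hK0 : 0 ≤ K := (abs_nonneg _).trans (hk₁ k₁ le_rfl)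
  refine ⟨2 * B * M + K + 1, 0, by positivity, fun ρ _ _ => ⟨k₁, fun k hk y _ => ?_⟩⟩
  haveI := isProbabilityMeasure_wilsonMeasure (d := 4) (L := 2 * sch.L k + 1) r.ρ r.continuous (sch.β k)
  set c := sch.c r.curvature k with hc
  set e := wilsonTorusMean r.ρ (sch.β k) (sch.L k) r.curvature.F with he
  set m₁ := sch.m r.curvature k with hm₁
  have hea : |e| ≤ M := abs_wilsonTorusMean_le r (sch.β k) (sch.L k) r.curvature hM
  have hκ : |c * (e - m₁)| ≤ K := hk₁ k hk
  -- the integrand is bounded by `2 B M + K`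
  have hφ : ∀ U : GaugeConfig 4 (2 * sch.L k + 1) G,
      |c * (r.curvature.F (configShift (-y) (torusLift (2 * sch.L k + 1) U)) - m₁)| ≤ 2 * B * M + K := by
    intro U
    set F := r.curvature.F (configShift (-y) (torusLift (2 * sch.L k + 1) U))
    have h1 : c * (F - m₁) = c * (F - e) + c * (e - m₁) := by ring
    rw [h1]
    calc |c * (F - e) + c * (e - m₁)| ≤ |c * (F - e)| + |c * (e - m₁)| := abs_add_le _ _
      _ ≤ 2 * B * M + K := by
          refine add_le_add ?_ hκ
          rw [abs_mul]
          calc |c| * |F - e| ≤ B * (M + M) :=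
                mul_le_mul (hB k) ((abs_sub _ _).trans (add_le_add (hM _) hea)) (abs_nonneg _) hB0
            _ = 2 * B * M := by ring
  calc _ ≤ 2 * B * M + K := rpow_integral_abs_condExp_pow_le _ (by positivity) hφ hn
    _ ≤ (2 * B * M + K + 1) * ρ ^ (-(0 : ℝ)) := by
        rw [neg_zero, Real.rpow_zero, mul_one]
        linarith

end Summit.QuantumFields.YangMills.Theorems.TemperedCurvatureMoments.Sketch

end
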